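import Literature.Topology.FourManifolds.BasinFlow
import HarnessLib

/-!
# Level points along non-critical trajectories of a basin setting

Topic `Literature/Topology/FourManifolds` (support file for the two-field handle-extension
endgame of `stmt-SmoothPoincare4-15190`, after `BasinFlow.lean`).  Everything here is
**proved**; no new definitions.

Milnor, *Lectures on the h-cobordism theorem* (1965), Thm. 4.1 (PDF p. 22) and the proof of
Thm. 5.4, Assertion 4 (PDF p. 29): points are moved *along the trajectories* of a gradient-like
field to a prescribed level.  For a basin setting `B : Literature.Topology.FourManifolds.BasinSetting g ξ`
(`BasinSetting.lean`) this file gives the `W`-typed bookkeeping of the level points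
`levelProj B.θ g ℓ z` (`LevelTranslation.lean`) along **non-critical** trajectories of the slab
flow, for levels of the slab `[lo, hi]` which may carry critical points elsewhere
(`SlabHittingTime.lean`): uniqueness (`levelProj_eq_θ_of_apply_eq`, `levelProj_eq_self`),
invariance along the trajectory (`levelProj_θ`, `levelProj_levelProj`), joint smoothness in the
point and the level (`contMDiffAt_levelProj_prod`, `contMDiffAt_levelProj`) and openness of the
hitting condition (`hits_mem_nhds'`).

## References

* J. Milnor, *Lectures on the h-cobordism theorem* (1965), Thm. 4.1 (PDF p. 22), proof of
  Thm. 5.4, Assertion 4 (PDF p. 29). [MilnorHCobordism1965]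
-/

open scoped Manifold ContDiff Topology
open Set Function Filter Metric

noncomputable section

namespace Literature.Topology.FourManifolds

open Cobordism FourManifolds.Flow

universe u

variable {n : ℕ} {W : Type u} [TopologicalSpace W] [T2Space W] [SecondCountableTopology W]
  [CompactSpace W] [ChartedSpace (EuclideanHalfSpace (n + 1)) W] [IsManifold (𝓡∂ (n + 1)) ∞ W]

/-! ### Level points along non-critical trajectories of one basin setting -/

namespace BasinSetting

variable {g : W → ℝ} {ξ : Π x : W, TangentSpace (𝓡∂ (n + 1)) x} (B : BasinSetting g ξ)

/-- A trajectory is critical at one time iff at all times. [cite: MilnorHCobordism1965, Def. 3.1 (PDF p. 11)] -/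
theorem isMCriticalPt_θ_iff (t : ℝ) (z : W) :
    IsMCriticalPt (𝓡∂ (n + 1)) g (B.θ (t, z)) ↔ IsMCriticalPt (𝓡∂ (n + 1)) g z :=
  B.slabFlow'.isMCriticalPt_apply_iff t

/-- **Uniqueness of hitting times along a non-critical trajectory** (levels in the slab). [cite: MilnorHCobordism1965, Thm. 4.1 (PDF p. 22)] -/
theorem hittingTime_eq_of_apply_θ_eq {z : W} (hz : ¬ IsMCriticalPt (𝓡∂ (n + 1)) g z) {ℓ : ℝ}
    (hℓ : ℓ ∈ Icc B.lo B.hi) {t : ℝ} (ht : g (B.θ (t, z)) = ℓ) : hittingTime B.θ g ℓ z = t :=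
  B.slabFlow'.hittingTime_eq_of_apply_eq hz hℓ ht

/-- **The level point is any point of the trajectory on the level** (non-critical trajectory). [cite: MilnorHCobordism1965, Thm. 4.1 (PDF p. 22)] -/
theorem levelProj_eq_θ_of_apply_eq {z : W} (hz : ¬ IsMCriticalPt (𝓡∂ (n + 1)) g z) {ℓ : ℝ}
    (hℓ : ℓ ∈ Icc B.lo B.hi) {t : ℝ} (ht : g (B.θ (t, z)) = ℓ) : levelProj B.θ g ℓ z = B.θ (t, z) := by
  rw [levelProj_apply, B.hittingTime_eq_of_apply_θ_eq hz hℓ ht]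

/-- A non-critical point of the level is its own level point. [folklore] -/
theorem levelProj_eq_self {z : W} (hz : ¬ IsMCriticalPt (𝓡∂ (n + 1)) g z) {ℓ : ℝ}
    (hℓ : ℓ ∈ Icc B.lo B.hi) (hzℓ : g z = ℓ) : levelProj B.θ g ℓ z = z := by
  rw [B.levelProj_eq_θ_of_apply_eq hz hℓ (t := 0) (by rw [B.θ_zero]; exact hzℓ), B.θ_zero]

/-- The level point lies on the level (if the trajectory meets it). [folklore] -/
theorem apply_levelProj {z : W} {ℓ : ℝ} (h : Hits B.θ g ℓ z) : g (levelProj B.θ g ℓ z) = ℓ :=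
  apply_hittingTime h

/-- The level point of a non-critical point is non-critical. [folklore] -/
theorem not_isMCriticalPt_levelProj {z : W} (hz : ¬ IsMCriticalPt (𝓡∂ (n + 1)) g z) (ℓ : ℝ) :
    ¬ IsMCriticalPt (𝓡∂ (n + 1)) g (levelProj B.θ g ℓ z) := by
  rw [levelProj_apply, B.isMCriticalPt_θ_iff]; exact hz

/-- Points of a trajectory meet the same levels. [folklore] -/
theorem hits_θ_iff (t : ℝ) (z : W) (ℓ : ℝ) : Hits B.θ g ℓ (B.θ (t, z)) ↔ Hits B.θ g ℓ z :=
  B.isSmoothFlow.hits_apply_iff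

/-- The level point meets the same levels as the point. [folklore] -/
theorem hits_levelProj_iff (z : W) (ℓ ℓ' : ℝ) : Hits B.θ g ℓ' (levelProj B.θ g ℓ z) ↔ Hits B.θ g ℓ' z := by
  rw [levelProj_apply]; exact B.hits_θ_iff _ z ℓ'

/-- **Level points are constant along non-critical trajectories.** [cite: MilnorHCobordism1965, Thm. 4.1 (PDF p. 22)] -/
theorem levelProj_θ {z : W} (hz : ¬ IsMCriticalPt (𝓡∂ (n + 1)) g z) {ℓ : ℝ} (hℓ : ℓ ∈ Icc B.lo B.hi)
    (hh : Hits B.θ g ℓ z) (t : ℝ) : levelProj B.θ g ℓ (B.θ (t, z)) = levelProj B.θ g ℓ z := by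
  obtain ⟨s, hs⟩ := hh
  have h1 : g (B.θ (s - t, B.θ (t, z))) = ℓ := by rw [B.θ_add, sub_add_cancel]; exact hs
  rw [B.levelProj_eq_θ_of_apply_eq ((B.isMCriticalPt_θ_iff t z).not.2 hz) hℓ h1, B.θ_add, sub_add_cancel,
    B.levelProj_eq_θ_of_apply_eq hz hℓ hs]

/-- Level points of level points. [folklore] -/
theorem levelProj_levelProj {z : W} (hz : ¬ IsMCriticalPt (𝓡∂ (n + 1)) g z) (ℓ : ℝ) {ℓ' : ℝ}
    (hℓ' : ℓ' ∈ Icc B.lo B.hi) (hh' : Hits B.θ g ℓ' z) :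
    levelProj B.θ g ℓ' (levelProj B.θ g ℓ z) = levelProj B.θ g ℓ' z := by
  rw [levelProj_apply B.θ g ℓ z]; exact B.levelProj_θ hz hℓ' hh' _

/-- Two points of one non-critical trajectory with the same level (in the slab) coincide. [cite: MilnorHCobordism1965, Thm. 4.1 (PDF p. 22)] -/
theorem θ_eq_of_apply_eq {z : W} (hz : ¬ IsMCriticalPt (𝓡∂ (n + 1)) g z) {t : ℝ}
    (hℓ : g z ∈ Icc B.lo B.hi) (ht : g (B.θ (t, z)) = g z) : B.θ (t, z) = z := by
  rw [← B.levelProj_eq_θ_of_apply_eq hz hℓ ht, B.levelProj_eq_self hz hℓ rfl]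

/-- **The level point is jointly smooth in the point and the level** (`W`-typed form of
`Cobordism.SlabFlow.contMDiffAt_levelPoint_prod`). [cite: MilnorHCobordism1965, Thm. 4.1 (PDF p. 22); proof of Thm. 5.4, Assertion 4 (PDF p. 29)] -/
theorem contMDiffAt_levelProj_prod {z₀ : W} (hz₀ : g z₀ ∈ Icc B.lo B.hi)
    (hreg : ¬ IsMCriticalPt (𝓡∂ (n + 1)) g z₀) {ℓ₀ : ℝ} (hℓ₀ : ℓ₀ ∈ Ioo B.lo B.hi) (hhit : Hits B.θ g ℓ₀ z₀) :
    ContMDiffAt ((𝓡∂ (n + 1)).prod 𝓘(ℝ, ℝ)) (𝓡∂ (n + 1)) ∞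
      (fun p : W × ℝ => levelProj B.θ g p.2 p.1) (z₀, ℓ₀) :=
  B.slabFlow'.contMDiffAt_levelPoint_prod hz₀ hreg hℓ₀ hhit

/-- The level point at a fixed level is smooth in the point. [cite: MilnorHCobordism1965, proof of Thm. 5.4, Assertion 4 (PDF p. 29)] -/
theorem contMDiffAt_levelProj {z₀ : W} (hz₀ : g z₀ ∈ Icc B.lo B.hi)
    (hreg : ¬ IsMCriticalPt (𝓡∂ (n + 1)) g z₀) {ℓ₀ : ℝ} (hℓ₀ : ℓ₀ ∈ Ioo B.lo B.hi) (hhit : Hits B.θ g ℓ₀ z₀) :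
    ContMDiffAt (𝓡∂ (n + 1)) (𝓡∂ (n + 1)) ∞ (levelProj B.θ g ℓ₀) z₀ := by
  have h : ContMDiffAt (𝓡∂ (n + 1)) (𝓡∂ (n + 1)) ∞
      ((fun p : W × ℝ => levelProj B.θ g p.2 p.1) ∘ fun z : W => (z, ℓ₀)) z₀ :=
    (B.contMDiffAt_levelProj_prod hz₀ hreg hℓ₀ hhit).comp z₀ (contMDiffAt_id.prodMk contMDiffAt_const)
  exact h

/-- **Near a non-critical point meeting a level of the open slab, all points meet it.** [cite: MilnorHCobordism1965, proof of Thm. 5.4, Assertion 4 (PDF p. 29)] -/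
theorem hits_mem_nhds' {z₀ : W} (hz₀ : g z₀ ∈ Icc B.lo B.hi)
    (hreg : ¬ IsMCriticalPt (𝓡∂ (n + 1)) g z₀) {ℓ₀ : ℝ} (hℓ₀ : ℓ₀ ∈ Ioo B.lo B.hi) (hhit : Hits B.θ g ℓ₀ z₀) :
    {z : W | Hits B.θ g ℓ₀ z} ∈ 𝓝 z₀ := by
  have h : {p : W × ℝ | Hits B.θ g p.2 p.1} ∈ 𝓝 (z₀, ℓ₀) := B.slabFlow'.hits_mem_nhds_prod hz₀ hreg hℓ₀ hhit
  exact (Continuous.prodMk_left ℓ₀).continuousAt.preimage_mem_nhds h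

/-- `Ioo (g p₀) hi ⊆ Ioo lo hi`. [folklore] -/
theorem Ioo_subset_Ioo_lo {ℓ : ℝ} (h : ℓ ∈ Ioo (g B.p₀) B.hi) : ℓ ∈ Ioo B.lo B.hi :=
  ⟨B.lo_lt_apply_p₀.trans h.1, h.2⟩

/-- Every level `g z` with `g z < hi` lies in the slab `[lo, hi]`. [folklore] -/
theorem apply_mem_slab {z : W} (hz : g z < B.hi) : g z ∈ Icc B.lo B.hi := ⟨(B.lo_lt_apply z).le, hz.le⟩

end BasinSetting

end Literature.Topology.FourManifolds
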